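import Literature.NumberTheory.EllipticCurves.BurungaleSkinnerTianWan2024.OrdinaryTwoVariableMainStatementSemistableOPEN
import Literature.NumberTheory.EllipticCurves.YanZhu2026.PerrinRiouCyclotomicRestriction
import Literature.NumberTheory.EllipticCurves.IwasawaSelmer
import HarnessLib

/-!
# Burungale–Skinner–Tian–Wan (arXiv:2409.01350v2, PREPRINT), §10.4.2 Thm. 10.10 (b) (label `IMC_ord`,
# p. 89), continued: the ONE-VARIABLE cases of statement 9.10 (label `St`, p. 81) for a semistable
# elliptic newform at an ordinary prime under (def)/(indef) — the cyclotomic case `· = cyc` and, in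
# the definite case (def) (root number of `E` over `L` equal to `+1`), the anticyclotomic case `· = ac`
# — plus the quadratic-twist clause, as explicitly labelled OPEN binders (claim-tagged; NEVER facts)
# over the tree's one-variable Selmer dual data `SelmerDualData` and the restrictions
# `cycRestrict` / `antiRestrict` of the refereed Yan–Zhu 2026 two-variable carrier `𝓛_p^PR`

Written by the typer seat `bsd-littype-01` (gen 7) of the cross-ladder literature-typing layer
(D-0088(4); cell `run/shared/lean/pub/bsd-littype/`). D-0064: companion of the same section's
`OrdinaryTwoVariableMainStatementSemistableOPEN.lean` (the two-variable cases `· = ∅` of 9.10 and 9.12,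
the conditions (def)/(indef), the hypothesis block `Thm1010bHypotheses`) and of gen 6's
`OrdinaryMainStatementSemistableOPEN.lean` (Thm. 10.10 (a)). HONEST FRAMING: UNREFEREED preprint ⇒
explicitly labelled OPEN hypotheses only (`def … : Prop`, `[claim: …, status: under-review]`), NEVER
theorems, NEVER `[cite:]`-facts; nothing asserted about any curve; no `_holds`. No new notion (every
carrier is the tree's); TWO OPEN binders; bookkeeping PROVED, including the anchoring of the cyclotomic
case to the tree's ONE-variable `p`-adic `L`-functions through the refereed Yan–Zhu Prop. 3.7.

## Printed statement and the cases typed here (arXiv:2409.01350v2, p. 89; tex l.7519–7530)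

"**Theorem 10.10.** Let `g ∈ S₂(Γ₀(N))` be an elliptic newform with `N` square-free and `p ∤ 2N` an
ordinary prime such that (irr_ℚ) holds. … (b) Let `L` be an imaginary quadratic field satisfying
`(D_L, 2N) = 1`, (2.15) and (irr_L). Suppose that either the condition (def) or (indef) holds. Then
Conj[.]s 9.10 and 9.12 are true. Moreover, the same holds for `g_K := g ⊗ χ_K` for any quadratic field
extension `K/ℚ` with `(D_K, Np) = 1`." Proof: "One may proceed just as in the proof of Theorem 10.8."
Statement 9.10 (p. 81, label `St`, l.6918–6927): "… `· ∈ {∅, cyc, ac}`. In the case `· = ac` suppose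
that the root number of `E` over `L` equals `+1`. (a) `X^·_•(g_{/L})` is `Λ^·_{L,𝒪_λ}`-torsion. (b) We
have an equality of ideals `(𝓛_p^{□,·}(g_{/L})) = ξ(X_•^·(g_{/L}))` in `Λ^·_{L,𝒪_λ} ⊗ ℚ_p` and even in
`Λ_L^·` if (irr_L) holds." The template, Thm. 10.8 (p. 88, l.7482–7493), lists exactly: statement 9.10
"for `· ∈ {∅, cyc}` … Moreover, the same holds for `· = ac` under the condition (def). In particular
[statement 9.12] is true for `· = ∅`"; its proof (pp. 88–89, l.7496–7510): cyclotomic equality from the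
cyclotomic statements over `ℚ` for `g` and `g ⊗ χ_L` by Lemma 9.17, two-variable equality by Thm. 10.5's
divisibility + non-vanishing of `𝓛_p^{cyc}` + [SU, Lem. 3.2], then "noting the non-vanishing of
`𝓛_p^{ac}(g_{/L})` under (def), the anticyclotomic main conj[.] follows by descent (cf. Proposition
10.7)"; Remark 10.9: "If the condition (indef) holds, then the anticyclotomic `p`-adic `L`-function …
vanishes by the interpolation property" — and for `N` square-free with `(D_L, N) = 1` the root number
of `E/L` is `−(−1)^{ν(N⁻)}`, `+1` under (def), `−1` under (indef), so 9.10-ac is claimed exactly under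
(def). THIS FILE TYPES: 9.10-cyc and 9.10-ac-under-(def) for `g = f_E` (one binder, two clauses), and
the twist clause. NOT typed (OPEN-QUESTIONS-01 §J, Q28–Q29): 9.12-cyc — clause (a) "`X_Gr^{cyc}`
torsion" amounts under the statement to `𝓛_p^{Gr,cyc}(g_{/L}) ≠ 0`, "an open problem" by the paper's own
Remark 9.13 (iii) (p. 81, l.6950–6953), and Thm. 10.8 claims 9.12 for `· = ∅` only: the literal
wording "Conj[.] 9.12 [is] true" of 10.10 (b) over-reaches its proof template there (LOCATED wording
row, not typed as a claim); 9.12-ac under (indef) — not listed by the template either (the tree HAS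
the carriers: `Castella2018.AcSelmer.XAc (W.baseChange K) p κ₂ v̄ ∅ γ₂` and `UnrSeries₂.minus G`;
typable on a consumer's demand as a separately flagged binder).

The objects (§9.1.2, p. 79, label `ordL`, l.6717–6727; §1.2.1 p. 7, l.703–707): `X^{cyc}(g_{/L})`,
`X^{ac}(g_{/L})` the Pontryagin duals of the ordinary Selmer groups over the cyclotomic / anticyclotomic
`ℤ_p`-extension of `L` (ordinary at `w ∣ p`, strict at `w ∈ Σ ∖ {p}`); "`𝓛_p^·(E_{/L}) ∈ Λ_L^·` the
associated Rankin–Selberg `p`-adic `L`-function interpolating … `L(1, E_L ⊗ χ)` for finite order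
characters `χ` of `Γ_L^·`" — the images of the two-variable `𝓛_p(g_{/L}) = 𝓛_v(g/L)` (§5.5.1, p. 55)
under `Λ_L → Λ_L^{cyc}` (Prop. 5.25 (ii), p. 55, l.4718–4724: `𝓛_v(g/L) mod (γ_ac − 1) = c(ω,γ,γ')
𝔤(χ_L)⁻¹ 𝓛_{α,ω,γ,γ'}(g/L)`, the product `𝓛_{α,ω,γ}(g)·𝓛_{α,ω',γ'}(g')` of §3.4.3, p. 31, l.2573–2579)
and `Λ_L → Λ_L^{ac}`.

## Transcription (E-instances; tree vocabulary only)

* `(κ₁, κ₂)` THE cyclotomic / anticyclotomic `ℤ_p`-extensions of `K = L` with an adapted generator pair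
  `(γ₁, γ₂)` (`ZpExtension.IsTopGeneratorPair`, as a `Fact`), so that the two-variable carrier
  `F ∈ ℚ_p⟦T⟧⟦S⟧` (`CycAntiSeries p`; outer `S ↔ γ₁`, inner `T ↔ γ₂`) restricts to the cyclotomic line by
  `cycRestrict` (kill `T`; = `ι ∘ toPlus` on `Λ_L`, `IwasawaAlgebra₂.cycRestrict_toCycAnti`) and to the
  anticyclotomic line by `antiRestrict` (kill `S`; = `ι ∘ constantCoeff` on `Λ_L`,
  `antiRestrict_toCycAnti` below) — the maps "`Λ_L → Λ_L^{cyc}`", "`Λ_L → Λ_L^{ac}`".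
* `X^{cyc}(E/L) ↦` ANY dual datum `X : (W.baseChange K).SelmerDualData κ₁ γ₁` (the Pontryagin dual of the
  classical `Sel_{p^∞}(E/L_∞^{cyc})` with its `Λ = ℤ_p⟦T⟧`-structure `1 + T ↦ γ₁`; = the source's ordinary
  Selmer dual at a good ordinary `p` — the identification used by every one-variable fact of the tree,
  e.g. `CastellaGrossiSkinner2025.thm723_…` for the SAME object `𝔛_ord(E/K_∞⁺)`; the source's strict
  condition at `w ∤ p` IS the classical one since `E(L_w) ⊗ ℚ_p/ℤ_p = 0`); `X^{ac}(E/L) ↦` ANY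
  `X : (W.baseChange K).SelmerDualData κ₂ γ₂`.
* `(𝓛_p^{cyc}(E/L)) = ξ(X^{cyc})` "in `Λ_L^{cyc}`" ↦ `∃ G : Λ, X.charIdeal = Ideal.span {G} ∧ ι G =
  cycRestrict (𝓛_p^PR)` with `𝓛_p^PR = perrinRiouLFunction W π F` for EVERY `F` in Hida's frame
  `IsHidaRankinLFunction ι W κ₁ κ₂ π.f F` — the shape of `CastellaGrossiSkinner2025.thm723_…` /
  `skinner_urban_main_conj…` clause 3; likewise `antiRestrict` on the anticyclotomic line. READING FLAG
  `BSTW-910-PR-normalisation` of the sibling (BSTW's `𝓛_p(g_{/L})` vs `𝓛_p^PR`: same ideal of `Λ_L` for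
  square-free `N`; cell reading), inherited by both restrictions. That the right-hand sides ARE images
  of elements of `Λ` is implied by the sibling's two-variable binder (PROVED:
  `exists_eq_cycRestrict_and_eq_antiRestrict_of_thm1010b_twoVariable_OPEN`).
* Hypotheses: the sibling's `Thm1010bHypotheses W p N K` (N.B. its `def_or_indef` field) + `κ₁`
  cyclotomic, `κ₂` anticyclotomic; the anticyclotomic clause asks `DefiniteCondition W p K N` ((def)).
* ANCHOR (PROVED, `exists_charIdeal_eq_span_padicLFunctionEK_of_thm1010b_OPEN_of_prop37`): granted the
  cyclotomic clause AND the refereed Yan–Zhu Prop. 3.7 (`YanZhu2026.prop37_cycRestrict_perrinRiou_eq_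
  padicLFunctionEK_rat`: `cycRestrict 𝓛_p^PR = p^k · u · L_p(f,α)L_p(g,α)`), for a generator `γ₁` matching
  the cyclotomic variable: `char(X^{cyc}(E/L)) = (G)` with `ι G = p^k · padicLFunctionEK` — statement 9.8
  (`cycBC`, p. 81) for `E` in the tree's period normalisation (up to `p^ℤ`), i.e. the product form of
  Thm. 10.10 (a) for `E` and `E^L` (Lemma 9.17 (i), p. 82) over the tree's `padicLFunction`.

WEAKER-OR-EQUAL to print except for the READING FLAG; never knowingly stronger. CONSUMERS: as the
sibling (K3 literal row D1; `bsd-cn100`; the X9/X11b lanes for the (def)/(indef) loci); ideation §J.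

## References
* [BurungaleSkinnerTianWan2024] arXiv:2409.01350v2: Thm. 10.10 (p. 89; `IMC_ord`, l.7519–7530);
  statement 9.10 (p. 81; `St`, l.6918–6927); Thm. 10.8 (p. 88; `KoMC'_eq`, l.7482–7493) and its proof
  (pp. 88–89, l.7496–7510); Rem. 10.9 (p. 89, l.7512–7514); Rem. 9.13 (iii) (p. 81, l.6950–6953);
  §9.1.2 (p. 79; `ordL`); §1.2.1 (p. 7, l.703–707); §5.5.1–5.5.2 (p. 55; Prop. 5.25, l.4707–4725);
  §3.4.3 (p. 31; `sspLcy`, l.2567–2581); Lemma 9.17 (p. 82; `Eq'`); (def) (Thm. 10.5, p. 87).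
* [YanZhu2024MainConjNonCM] J. Algebra 693 (2026): Thm. 3.3 / Def. 3.4 (carriers), Prop. 3.7 (anchor;
  tree `YanZhu2026/PerrinRiouCyclotomicRestriction.lean`).
* [CastellaGrossiSkinner2025] Math. Ann. 393, Thm. 7.2.3 / Prop. 2.2.4 — the same cyclotomic object
  over `K` in the tree (`PerrinRiouMainConjecture.lean`), shape reused.
-/

noncomputable section

open scoped Classical

open PowerSeries NumberField IsDedekindDomain Field CongruenceSubgroup
  Literature.NumberTheory.GaloisRepresentations Literature.NumberTheory.EllipticCurves
  Literature.NumberTheory.EllipticCurves.ModularForms Literature.NumberTheory.EllipticCurves.Rank1Residual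

/-! ### Restriction to the anticyclotomic line commutes with `Λ_L ↪ ℚ_p⟦T⟧⟦S⟧` -/

namespace Literature.NumberTheory.EllipticCurves.IwasawaAlgebra₂

variable (p : ℕ) [Fact p.Prime]

/-- **`Λ_L → Λ_L^{ac}` on series**: killing the OUTER (cyclotomic) variable of `ι(G)` (`antiRestrict`,
`S = 0`) is `ι` of the constant coefficient of `G ∈ Λ_L = ℤ_p⟦T₂⟧⟦T₁⟧` in the outer variable — the
companion of `cycRestrict_toCycAnti` (`Λ_L → Λ_L^{cyc}`), i.e. the map under which the two-variable
`𝓛_p(g_{/L})` projects to `𝓛_p^{ac}(g_{/L})`. Coefficientwise bookkeeping.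
[cite: BurungaleSkinnerTianWan2024, §1.2.1 (p. 7; tex l.703–707: 𝓛_p^·(E/L) ∈ Λ_L^· for · ∈ {∅, cyc, ac}) (shape)]
[cite: YanZhu2024MainConjNonCM, §3.5 (Λ_K → Λ_K^{±}, arXiv:2412.20078v4 TeX l.894) (shape)] -/
theorem antiRestrict_toCycAnti (G : IwasawaAlgebra₂ p) :
    antiRestrict (toCycAnti p G) = iwasawaToPowerSeries p (PowerSeries.constantCoeff G) := by
  ext n
  rw [antiRestrict_eq_cycTaylorCoeff_zero, cycTaylorCoeff, coeff_coeff_toCycAnti,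
    PowerSeries.coeff_zero_eq_constantCoeff_apply]
  simp [iwasawaToPowerSeries, PowerSeries.coeff_map]

end Literature.NumberTheory.EllipticCurves.IwasawaAlgebra₂

namespace Literature.NumberTheory.EllipticCurves.BurungaleSkinnerTianWan2024

open IwasawaAlgebra₂

/-! ### The OPEN binders: Thm. 10.10 (b), statement 9.10 for `· = cyc` and (under (def)) `· = ac`;
twist clause -/

/-- **OPEN HYPOTHESIS — UNREFEREED PREPRINT (arXiv:2409.01350v2), Thm. 10.10 (b), statement 9.10 in the
ONE-VARIABLE cases (pp. 89, 81), for `g = f_E`: `· = cyc`, and `· = ac` under (def).** Under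
`Thm1010bHypotheses W p N K` (`N` square-free, `p ∤ 2N` ordinary, (irr_ℚ), `L` imaginary quadratic with
`(D_L, 2N) = 1`, (ord), (irr_L), (def) or (indef)), with `(κ₁, κ₂)` THE cyclotomic / anticyclotomic pair
and adapted generators `(γ₁, γ₂)`: (cyc) "`X^{cyc}(g_{/L})` is `Λ^{cyc}_L`-torsion [and]
`(𝓛_p^{cyc}(g_{/L})) = ξ(X^{cyc}(g_{/L}))` in `Λ_L^{cyc}`" ↦ every dual datum
`X : (W.baseChange K).SelmerDualData κ₁ γ₁` is torsion and, for every modular parametrisation `π` at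
level `N` and EVERY `F` in Hida's frame `IsHidaRankinLFunction ι W κ₁ κ₂ π.f F`, `char(X) = (G)` with
`ι G = cycRestrict (perrinRiouLFunction W π F)`; (ac, under `DefiniteCondition W p K N` — root number
`+1`, the printed proviso of 9.10 for `· = ac`; Thm. 10.8: "the same holds for `· = ac` under the
condition (def)") ↦ the same for `X : (W.baseChange K).SelmerDualData κ₂ γ₂` with `antiRestrict`.
READING FLAG `BSTW-910-PR-normalisation` (module docstring of the sibling). NEVER cite this `Prop` as a
theorem (no journal version, 2026-08-27); take it as an explicit hypothesis.
[claim: BurungaleSkinnerTianWan2024, status: under-review]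
[cite: BurungaleSkinnerTianWan2024, Thm. 10.10 (b) (p. 89; label IMC_ord, tex l.7523–7524; ANNOUNCED, OPEN binder) with statement 9.10 (p. 81; label St, l.6918–6927), cases · = cyc and · = ac, read through Thm. 10.8 (p. 88, l.7482–7493) and §1.2.1 (p. 7, l.703–707)] -/
def thm1010b_standardMainStatement_oneVariable_OPEN : Prop :=
  ∀ {p : ℕ} [Fact p.Prime] (ι : integralClosure ℚ ℂ →+* ℂ_[p]) (W : WeierstrassCurve ℚ) [W.IsElliptic]
    [W.IsGloballyMinimal] (K : Type) [Field K] [NumberField K] (κ₁ κ₂ : ZpExtension K p)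
    (γ₁ γ₂ : absoluteGaloisGroup K) [Fact (ZpExtension.IsTopGeneratorPair κ₁ κ₂ γ₁ γ₂)]
    {N : ℕ} [NeZero N] (π : ModularParametrizationData W N),
    Thm1010bHypotheses W p N K → κ₁.IsCyclotomic → κ₂.IsAnticyclotomic →
    -- · = cyc
    (∀ X : (W.baseChange K).SelmerDualData κ₁ γ₁,
      X.IsTorsion ∧
        ∀ F : CycAntiSeries p, IsHidaRankinLFunction ι W κ₁ κ₂ π.f F →
          ∃ G : IwasawaAlgebra p, X.charIdeal = Ideal.span {G} ∧
            iwasawaToPowerSeries p G = cycRestrict (perrinRiouLFunction W π F)) ∧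
    -- · = ac, under (def)
    (DefiniteCondition W p K N →
      ∀ X : (W.baseChange K).SelmerDualData κ₂ γ₂,
        X.IsTorsion ∧
          ∀ F : CycAntiSeries p, IsHidaRankinLFunction ι W κ₁ κ₂ π.f F →
            ∃ G : IwasawaAlgebra p, X.charIdeal = Ideal.span {G} ∧
              iwasawaToPowerSeries p G = antiRestrict (perrinRiouLFunction W π F))

/-- **OPEN HYPOTHESIS — UNREFEREED PREPRINT (arXiv:2409.01350v2), Thm. 10.10, QUADRATIC-TWIST clause of
part (b), statement 9.10, one-variable cases (p. 89).** "Moreover, the same holds for `g_K := g ⊗ χ_K`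
for any quadratic field extension `K/ℚ` with `(D_K, Np) = 1`." Transcribed as the sibling's twist
binders: hypotheses `Thm1010bHypotheses W₀ p N₀ K` on the semistable `E₀`; `d ≠ 1` square-free, every
prime ramified in `ℚ(√d)` `≠ p` and `∤ N₀` (`RamifiedInQuadratic`); `W` a globally minimal model of
`E₀^{(d)}` (`C • W = W₀.quadraticTwist d`) with a parametrisation `π` at its conductor `N`; conclusion:
the cyc clause, and under (def) (asked of `g`) the ac clause, for `W` over `L`. NEVER cite this `Prop`
as a theorem (OPEN-QUESTIONS-01 Q17). [claim: BurungaleSkinnerTianWan2024, status: under-review]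
[cite: BurungaleSkinnerTianWan2024, Thm. 10.10, last sentence (p. 89; label IMC_ord, tex l.7525; ANNOUNCED, OPEN binder), part (b), statement 9.10 cases · = cyc, ac] -/
def thm1010b_twist_standardMainStatement_oneVariable_OPEN : Prop :=
  ∀ {p : ℕ} [Fact p.Prime] (ι : integralClosure ℚ ℂ →+* ℂ_[p]) (W₀ W : WeierstrassCurve ℚ)
    [W₀.IsElliptic] [W₀.IsGloballyMinimal] [W.IsElliptic] [W.IsGloballyMinimal] (d : ℤ)
    (C : WeierstrassCurve.VariableChange ℚ) (K : Type) [Field K] [NumberField K]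
    (κ₁ κ₂ : ZpExtension K p) (γ₁ γ₂ : absoluteGaloisGroup K)
    [Fact (ZpExtension.IsTopGeneratorPair κ₁ κ₂ γ₁ γ₂)] {N₀ N : ℕ} [NeZero N]
    (π : ModularParametrizationData W N),
    Thm1010bHypotheses W₀ p N₀ K →
    Squarefree d → d ≠ 1 → (∀ (q : ℕ) [Fact q.Prime], RamifiedInQuadratic d q → q ≠ p ∧ ¬ q ∣ N₀) →
    C • W = W₀.quadraticTwist (d : ℚ) → (N : ℤ) = W.conductorNorm ℤ →
    κ₁.IsCyclotomic → κ₂.IsAnticyclotomic →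
    (∀ X : (W.baseChange K).SelmerDualData κ₁ γ₁,
      X.IsTorsion ∧
        ∀ F : CycAntiSeries p, IsHidaRankinLFunction ι W κ₁ κ₂ π.f F →
          ∃ G : IwasawaAlgebra p, X.charIdeal = Ideal.span {G} ∧
            iwasawaToPowerSeries p G = cycRestrict (perrinRiouLFunction W π F)) ∧
    (DefiniteCondition W₀ p K N₀ →
      ∀ X : (W.baseChange K).SelmerDualData κ₂ γ₂,
        X.IsTorsion ∧
          ∀ F : CycAntiSeries p, IsHidaRankinLFunction ι W κ₁ κ₂ π.f F →
            ∃ G : IwasawaAlgebra p, X.charIdeal = Ideal.span {G} ∧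
              iwasawaToPowerSeries p G = antiRestrict (perrinRiouLFunction W π F))

/-! ### Bookkeeping (binder ⇒ shape), all CONDITIONAL on the OPEN binders; nothing is closed -/

section Bookkeeping

variable {p : ℕ} [Fact p.Prime] {K : Type} [Field K] [NumberField K]

/-- **The right-hand sides ARE images of elements of `Λ`, granted the sibling's two-variable binder**:
if `char(X(E/L_∞)) = (g)` with `ι(g) = 𝓛_p^PR` (the conclusion of
`thm1010b_standardMainStatement_twoVariable_OPEN`), then `toPlus g ∈ Λ_L^{cyc}` and the outer constant
coefficient of `g` map to `cycRestrict 𝓛_p^PR` and `antiRestrict 𝓛_p^PR` — the candidate generators on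
the two lines ("`𝓛_p^{cyc}`, `𝓛_p^{ac}` are the images of `𝓛_p` under `Λ_L → Λ_L^·`"). CONDITIONAL;
closes nothing. [claim: BurungaleSkinnerTianWan2024, status: under-review]
[cite: BurungaleSkinnerTianWan2024, Thm. 10.10 (b) (p. 89) with §1.2.1 (p. 7, l.703–707) and Prop. 5.25 (ii) (p. 55) (OPEN binder; bookkeeping)] -/
theorem exists_eq_cycRestrict_and_eq_antiRestrict_of_thm1010b_twoVariable_OPEN
    (hBSTW_OPEN : thm1010b_standardMainStatement_twoVariable_OPEN)
    (ι : integralClosure ℚ ℂ →+* ℂ_[p]) (W : WeierstrassCurve ℚ) [W.IsElliptic] [W.IsGloballyMinimal]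
    (κ₁ κ₂ : ZpExtension K p) (γ₁ γ₂ : absoluteGaloisGroup K)
    [Fact (ZpExtension.IsTopGeneratorPair κ₁ κ₂ γ₁ γ₂)] {N : ℕ} [NeZero N]
    (π : ModularParametrizationData W N) (hyp : Thm1010bHypotheses W p N K)
    {F : CycAntiSeries p} (hF : IsHidaRankinLFunction ι W κ₁ κ₂ π.f F) :
    ∃ g : IwasawaAlgebra₂ p,
      WeierstrassCurve.XOrd₂.charIdeal (W.baseChange K) p κ₁ κ₂ γ₁ γ₂ = Ideal.span {g} ∧
      iwasawaToPowerSeries p (toPlus p g) = cycRestrict (perrinRiouLFunction W π F) ∧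
      iwasawaToPowerSeries p (PowerSeries.constantCoeff g) = antiRestrict (perrinRiouLFunction W π F) := by
  obtain ⟨g, hgL, hspan⟩ :=
    exists_charIdealXOrd₂_eq_span_of_thm1010b_OPEN hBSTW_OPEN ι W κ₁ κ₂ γ₁ γ₂ π hyp hF
  exact ⟨g, hspan, by rw [← cycRestrict_toCycAnti, hgL], by rw [← antiRestrict_toCycAnti, hgL]⟩

/-- **Granted the one-variable binder: statement 9.10 (a) on the cyclotomic line** — every dual datum of
`Sel_{p^∞}(E/L_∞^{cyc})` is `Λ`-torsion. CONDITIONAL; closes nothing.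
[claim: BurungaleSkinnerTianWan2024, status: under-review]
[cite: BurungaleSkinnerTianWan2024, Thm. 10.10 (b) (p. 89) with statement 9.10 (a), · = cyc (p. 81) (OPEN binder; bookkeeping)] -/
theorem selmerDual_cyc_isTorsion_of_thm1010b_OPEN
    (hBSTW_OPEN : thm1010b_standardMainStatement_oneVariable_OPEN)
    (ι : integralClosure ℚ ℂ →+* ℂ_[p]) (W : WeierstrassCurve ℚ) [W.IsElliptic] [W.IsGloballyMinimal]
    (κ₁ κ₂ : ZpExtension K p) (γ₁ γ₂ : absoluteGaloisGroup K)
    [Fact (ZpExtension.IsTopGeneratorPair κ₁ κ₂ γ₁ γ₂)] {N : ℕ} [NeZero N]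
    (π : ModularParametrizationData W N) (hyp : Thm1010bHypotheses W p N K) (hκ₁ : κ₁.IsCyclotomic)
    (hκ₂ : κ₂.IsAnticyclotomic) (X : (W.baseChange K).SelmerDualData κ₁ γ₁) : X.IsTorsion :=
  ((hBSTW_OPEN ι W K κ₁ κ₂ γ₁ γ₂ π hyp hκ₁ hκ₂).1 X).1

/-- **Granted the one-variable binder, in the definite case: statement 9.10 (a) on the anticyclotomic
line** — every dual datum of `Sel_{p^∞}(E/L_∞^{ac})` is `Λ`-torsion. CONDITIONAL; closes nothing.
[claim: BurungaleSkinnerTianWan2024, status: under-review]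
[cite: BurungaleSkinnerTianWan2024, Thm. 10.10 (b) (p. 89) with statement 9.10 (a), · = ac under (def) (pp. 81, 87–88) (OPEN binder; bookkeeping)] -/
theorem selmerDual_ac_isTorsion_of_thm1010b_OPEN_of_definite
    (hBSTW_OPEN : thm1010b_standardMainStatement_oneVariable_OPEN)
    (ι : integralClosure ℚ ℂ →+* ℂ_[p]) (W : WeierstrassCurve ℚ) [W.IsElliptic] [W.IsGloballyMinimal]
    (κ₁ κ₂ : ZpExtension K p) (γ₁ γ₂ : absoluteGaloisGroup K)
    [Fact (ZpExtension.IsTopGeneratorPair κ₁ κ₂ γ₁ γ₂)] {N : ℕ} [NeZero N]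
    (π : ModularParametrizationData W N) (hyp : Thm1010bHypotheses W p N K) (hκ₁ : κ₁.IsCyclotomic)
    (hκ₂ : κ₂.IsAnticyclotomic) (hdef : DefiniteCondition W p K N)
    (X : (W.baseChange K).SelmerDualData κ₂ γ₂) : X.IsTorsion :=
  ((hBSTW_OPEN ι W K κ₁ κ₂ γ₁ γ₂ π hyp hκ₁ hκ₂).2 hdef X).1

/-- `p ≠ 2` prime ⟹ `3 ≤ p` (to feed the tree's `3 ≤ p`-hypotheses). [folklore] -/
private theorem three_le_of_ne_two {p : ℕ} [hp : Fact p.Prime] (h : p ≠ 2) : 3 ≤ p := by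
  have := hp.out.two_le
  omega

/-- **ANCHOR to the tree's one-variable `p`-adic `L`-functions — granted the cyclotomic clause AND the
refereed Yan–Zhu Prop. 3.7 (tree form, up to `p^ℤ · Λˣ`):** for `(κ₁, κ₂)` the cyclotomic/anticyclotomic
pair whose generator `γ₁` matches the cyclotomic variable of `padicLFunction`
(`IsCyclotomicVariable p (absGaloisRestrict ℚ K γ₁)`), and `g` the newform of the twist `E^L =
W^{(D_L)}`: every dual datum `X` of `Sel_{p^∞}(E/L_∞^{cyc})` is torsion with `char(X) = (G)`,
`ι G = p^k · L_p(f, α) · L_p(g, α)` (`padicLFunctionEK`, `α = unitRoot W p`; split `p`) for some `k ∈ ℤ`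
— statement 9.8 (`cycBC`, p. 81) for `E` in the tree's period normalisation, the product form of
Thm. 10.10 (a) for `E` and `E^L` via Lemma 9.17 (i) (p. 82) = the shape of
`CastellaGrossiSkinner2025.thm723_…` off the Eisenstein locus. The unit `u` of Prop. 3.7 is absorbed into
the generator. CONDITIONAL on the OPEN binder; closes nothing.
[claim: BurungaleSkinnerTianWan2024, status: under-review]
[cite: BurungaleSkinnerTianWan2024, Thm. 10.10 (b) (p. 89) with statement 9.8 (p. 81; label cycBC) and Lemma 9.17 (i) (p. 82; label Eq') (OPEN binder; bookkeeping)]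
[cite: YanZhu2024MainConjNonCM, Prop. 3.7 (arXiv:2412.20078v4 TeX l.821–829; tree fact prop37_cycRestrict_perrinRiou_eq_padicLFunctionEK_rat)] -/
theorem exists_charIdeal_eq_span_padicLFunctionEK_of_thm1010b_OPEN_of_prop37
    (hBSTW_OPEN : thm1010b_standardMainStatement_oneVariable_OPEN)
    (h37 : YanZhu2026.prop37_cycRestrict_perrinRiou_eq_padicLFunctionEK_rat)
    (ι : integralClosure ℚ ℂ →+* ℂ_[p]) (W : WeierstrassCurve ℚ) [W.IsElliptic] [W.IsGloballyMinimal]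
    (κ₁ κ₂ : ZpExtension K p) (γ₁ γ₂ : absoluteGaloisGroup K)
    [Fact (ZpExtension.IsTopGeneratorPair κ₁ κ₂ γ₁ γ₂)] {N N' : ℕ} [NeZero N] [NeZero N']
    (π : ModularParametrizationData W N) {g : CuspForm (Gamma0 N') 2}
    (hg : IsNewformOf (W.quadraticTwist (NumberField.discr K : ℚ)) g)
    (hyp : Thm1010bHypotheses W p N K) (hκ₁ : κ₁.IsCyclotomic) (hκ₂ : κ₂.IsAnticyclotomic)
    (hγ₁ : IsCyclotomicVariable p (absGaloisRestrict ℚ K γ₁))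
    {F : CycAntiSeries p} (hF : IsHidaRankinLFunction ι W κ₁ κ₂ π.f F)
    (X : (W.baseChange K).SelmerDualData κ₁ γ₁) :
    X.IsTorsion ∧ ∃ (G : IwasawaAlgebra p) (k : ℤ), X.charIdeal = Ideal.span {G} ∧
      iwasawaToPowerSeries p G =
        PowerSeries.C ((p : ℚ_[p]) ^ k) * padicLFunctionEK W p K π.isNewformOf hg := by
  obtain ⟨htor, hmc⟩ := (hBSTW_OPEN ι W K κ₁ κ₂ γ₁ γ₂ π hyp hκ₁ hκ₂).1 X
  obtain ⟨G, hspan, hG⟩ := hmc F hF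
  obtain ⟨u, k, hu⟩ := h37 ι W K κ₁ κ₂ γ₁ γ₂ π hg (three_le_of_ne_two hyp.two_ne) hyp.goodOrd
    hyp.isImaginaryQuadratic hyp.split (hyp.coprime.of_mul_left_right) hκ₁ hκ₂ hγ₁ F hF
  refine ⟨htor, ↑u⁻¹ * G, k, ?_, ?_⟩
  · rw [hspan]
    exact (Ideal.span_singleton_mul_left_unit (Units.isUnit u⁻¹) G).symm
  · rw [map_mul, hG, hu, ← mul_assoc, ← mul_assoc, mul_comm (iwasawaToPowerSeries p ↑u⁻¹),
      mul_assoc (PowerSeries.C ((p : ℚ_[p]) ^ k)), ← map_mul, Units.inv_mul, map_one, mul_one]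

end Bookkeeping

end Literature.NumberTheory.EllipticCurves.BurungaleSkinnerTianWan2024

end
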